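/-
Copyright: cell pub-balaban-gaps, seat ne8 (estimate NE7c), gen 18. Project licence.
-/
import Literature.MathematicalPhysics.QuantumFieldTheory.Balaban1983to89.T4ShellMeasure
import Literature.MathematicalPhysics.QuantumFieldTheory.Balaban1983to89.T4GenFunBounds

/-!
# Road (δ)'s END-TO-END constructor on the JOINT-LAW MODEL and AT LEVEL 0 ON THE LATTICE: a battery of `S` sharp threshold tests of
# ARBITRARILY DEPENDENT observables under ANY probability law — in particular the plaquette action densities `1 − Re tr U(∂p)` under
# WILSON's GIBBS MEASURE along ANY torus scheme of the cell, step `K` against step `K + 1` — fires `T4ShellMeasure.shellWeightBound_of_liveFactor`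
# BY NAME with the cascade constant `V = S`; file 38's independence was inessential (row NE7c; junction J-25; MODEL ∕ LATTICE MODEL, [folklore])

Cell `pub-balaban-gaps` (G2), seat ne8, estimate **NE7c** (`T4IndicatorShell.ShellWeightBound`; two-run artefact, NOT PRINTED in [Bałaban 1983–89], NOT
PROVED).  Proof-only file under `Spine/NE7c/`: imports the tree's `Balaban1983to89.T4ShellMeasure` (`twoSidedShell`, `twoSidedShell_disjoint`,
`candidateCount_spec`, `SlotLedger.of_realized`, `shellWeightBound_of_liveFactor`) and `Balaban1983to89.T4GenFunBounds` (`gibbsMeasure`,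
`isProbabilityMeasure_gibbsMeasure`; through it `Missing.TorusScheme`, `Missing.plaqLoop`, `Missing.measurable_plaqLoop'`, `Setup.GaugeField`).  Companion of
this seat's files 37 `LiveFactorOneStageModel` (J-20: ONE test, any law) and 38 `LiveFactorProductStageModel` (J-21: `S` INDEPENDENT tests, `V = S`).  Mathlib
measure theory otherwise.  Nothing of Bałaban's is named beyond the DEFINITIONS `plaqLoop = Re tr U(∂p)` ([B12] (0.2)) and the cell's torus objects; no
`def`; 0 `sorry`.

THE QUESTIONS (left open by files 37∕38; `ne/NE7c.md` §2 «UNCONDITIONAL INSTANCES (the only ones): (M1)₀ … `slotAntiConcentration_wilson_su2`» — road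
(γ_loc)'s level-0 instance on the cell's configuration space; road (δ) had NONE on a lattice object).  (a) File 38 obtained `V = S` for `S` INDEPENDENT tests
(product laws).  In Bałaban's expansion the tested variables — plaquette variables of ONE minimiser ([B14] (2.17)) — are anything but independent: is the
product structure needed for `V = S`, or only for the bookkeeping?  (b) Does road (δ)'s typed constructor fire on a genuine LATTICE-GAUGE object of the tree
(a Gibbs measure of gauge fields on the cell's torus, plaquette functionals as tests), as road (γ_loc)'s (M1)₀ does?

ANSWER ([folklore]).
* §1 THE ABSTRACT FIXED BATTERY (any finite term set `ι`, any finite slot set `κ`, no source dependence): `realizedLedger_slots` (a realized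
  `SlotLedger` for EVERY choice function from `0 ≤ sh ≤ A`, `sh ≤ Σ_s piece_s`, `piece ≥ 0`, `Σ_τ A = 1`), `candidateTotals_slots_le`
  (`Σ_{i<n} Σ_s Σ_τ piece ≤ #κ` from the per-slot bound `Σ_{i<n} Σ_τ piece_{K,i}(s, ·) ≤ 1`), **`shellWeightBound_slots`**: the two-run pigeonhole
  `exists_liveFactor_choice_function` (`V = #κ`, `Z = 1`, `M = 4c₁∕β′`) and `shellWeightBound_of_realized` FIRE for ANY such two systems on a common term set:
  ONE `i⋆` with BOTH runs' chosen shell totals `Σ_s Σ_τ piece^X_{K,i⋆K} ≤ (#κ·4c₁∕β′)·ϑ^K` for every `K` (the explicit geometric ceiling, exported) AND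
  `ShellWeightBound` BY NAME with `Wsh K = Σ_s Σ_τ piece^A_{K,i⋆K} + Σ_s Σ_τ piece^B_{K,i⋆K}` (`≤ 2·(#κ·4c₁∕β′)·ϑ^K`).
* §2 THE JOINT-LAW MODEL.  Run `X`'s `K`-th comparison lives on ITS OWN probability space `(Ω^X_K, P^X_K)` — ANY — and tests `S` measurable observables
  `u^X_{K,σ} : Ω^X_K → ℝ`, ARBITRARILY DEPENDENT, against `θ_{K,σ}·(1 − c₁ϑ^K)^i`.  TERMS = the `2^S` CELLS `ω : Fin S → Bool` of the battery
  (`⋂_σ {u_σ < θ_σλ}` or `{u_σ ≥ θ_σλ}` as `ω_σ` dictates; weight = the cell's probability: `cell_disjoint`, `iUnion_cell`, `measurableSet_cell`,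
  **`sum_measureReal_cell_inter`** — the cells PARTITION, `Σ_ω P(cell_ω ∩ E) = P(E)` —, `sum_measureReal_cell`); SHELL PART of a cell = its mass on «some
  `u_σ` within its two-sided shell `twoSidedShell θ_{K,σ} (c₁ϑ^K) ρ^X_{K,σ} i`» (where the other run's sharp indicator may disagree under two-run closeness of
  radius `ρ` in threshold units), slot `σ`'s piece = the cell's mass on «`u_σ` in its shell» (`measureReal_inter_iUnion_le`: the union bound is the ledger's
  `cover`); the ONLY place the law enters: **`sum_measureReal_preimage_twoSidedShell_le_one`** — the `n` candidate shells of ONE observable are disjoint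
  (`twoSidedShell_disjoint`, `2ρ ≤ c₁ϑ^K ≤ 1`), so their probabilities sum to `≤ 1`.  **`shellWeightBound_jointLaw`**: ONE choice function `i⋆` with
  `Σ_σ P^X_K{u^X_{K,σ} ∈ shell_{i⋆K}} ≤ (S·4c₁∕β′)·ϑ^K` for BOTH runs and every `K`, and `ShellWeightBound` BY NAME,
  `Wsh K = Σ_σ P^A_K{u^A_{K,σ} ∈ shell_{i⋆K}} + Σ_σ P^B_K{u^B_{K,σ} ∈ shell_{i⋆K}}`, `V = S`.
* §3 THE LEVEL-0 LATTICE INSTANCE **`shellWeightBound_wilsonScheme`**: `G` any regular gauge group of the tree (`[RegularGaugeGroup G] [HaarData G]`: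
  `U(N)`, `SU(N)`), `Sch` ANY `Missing.TorusScheme G O` with `β_K ≥ 0` (the object whose continuum limit is the headline); run A = Wilson's Gibbs measure
  `Z⁻¹e^{−β_K A(U)}∏_b dU(b)` on the configurations `GaugeField (Sch.P K) 0 G` of `T^{(0)}_K` (`T4GenFunBounds.gibbsMeasure`), run B = the same at step
  `K + 1`; tests = the plaquette action densities `1 − Re tr U(∂p^X_{K,σ})` of `S` chosen plaquettes per run (functions of ONE interacting gauge field).
  The constructor FIRES: ONE common live factor index `i⋆ K` per `K` with `Σ_σ Gibbs_K{1 − Re tr U(∂p^A_σ) ∈ shell_{i⋆K}} ≤ (S·4c₁∕β′)·ϑ^K`, the same at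
  step `K + 1`, and `ShellWeightBound` with `Wsh K = Σ_σ Gibbs_K{1 − Re tr U(∂p^A_σ) ∈ shell} + Σ_σ Gibbs_{K+1}{1 − Re tr U(∂p^B_σ) ∈ shell}`.

WHAT THIS SHOWS ∕ DOES NOT SHOW (honest).  SHOWS: (i) of an `S`-test battery the (δ-1) constructor consumes ONLY the σ-additivity of each run's law —
`V = S` under ANY dependence between the tested observables; file 38's product structure was bookkeeping, not an input; hence the factor between `S` and
`T4ShellMeasure` §8's cascade count `2(∏_σ(ν_σ + 1) − 1)` (sharp: file 39) is the price of ADAPTIVITY of the decision tree alone (history-dependent choice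
of WHICH variable is tested against WHICH threshold), not of statistical dependence; (ii) road (δ)'s typed chain now has a LATTICE-level model instance —
level 0, Wilson's Gibbs measure of every torus scheme of the cell (every `β_K ≥ 0`, every regular `G`, any `S` plaquettes, the two runs = consecutive steps of
the scheme) — beside road (γ_loc)'s (M1)₀ `ShellMeasureWilsonRealizedSU2.slotAntiConcentration_wilson_su2`; unlike (M1)₀ it needs no chart, no window
`S ≤ 1∕8`, no (SM)₀ smallness, no `SU(2)`: positivity of measures only.  DOES NOT SHOW: anything at levels `j ≥ 1` or about Bałaban's terms [B14] (2.18)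
(node O: the ADAPTIVE `K`-level decision tree over block-averaged minimisers as a Lean object — the tests here are a FIXED battery on the bare field), nor
(L1-step) (consumed downstream by files 1–36), nor two-run closeness (node U1b ∕ NE3: the radii `ρ^X_{K,σ}` are free parameters here, only `2ρ ≤ c₁ϑ^K` is
used).  BY-NAME EFFECT ON THE WALL: none (MODEL).  VERDICT WORD UNCHANGED: WORK-bound behind node O; INSTANCE 0∕1 (the one call of record).  NE7c ∕ NE7b NOT
PRINTED ∕ NOT PROVED; spine 0∕9; one finite T⁴ — NOT ℝ⁴, NOT infinite volume, NOT the mass gap, NOT Clay.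
HONEST DEPENDENCY (cell): continuum YM on T⁴ ⇐ BetaPertH ∧ nine spine estimates (0∕9 proved); BetaPertH ⇐ (D1) ∧ (D4) ∧ CAP+tail.
-/

set_option autoImplicit false

noncomputable section

open MeasureTheory Finset Set
open Literature.MathematicalPhysics.QuantumFieldTheory.Balaban1983to89
open Literature.MathematicalPhysics.QuantumFieldTheory.Balaban1983to89.T4ShellMeasure

namespace Summit.QuantumFields.BalabanUV.T4Continuum.Spine.NE7c.LiveFactorJointLawModel

/-! ## §1 The abstract slot system of a FIXED battery: any finite term set, unit total weight, per-slot candidate-summed pieces `≤ 1` — the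
constructor fires with `V = #slots` -/

section Abstract

variable {ι κ : Type*} [Fintype ι] [Fintype κ] (A sh : ℕ → ℕ → ι → ℝ) (piece : ℕ → ℕ → κ → ι → ℝ)

/-- **THE REALIZED LEDGER OF A FIXED BATTERY, FOR EVERY CHOICE FUNCTION** (`SlotLedger.of_realized`, tilt `a = 0`, no source dependence):
terms `τ ∈ ι` with weights `A_{K,i}(τ)`, shell parts `0 ≤ sh ≤ A` covered by the per-slot pieces `Σ_s piece_{K,i}(s, τ)`, pieces `≥ 0`, unit total
weight `Σ_τ A_{K,i}(τ) = 1`. [folklore] -/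
theorem realizedLedger_slots (h0 : ∀ K i τ, 0 ≤ sh K i τ) (hle : ∀ K i τ, sh K i τ ≤ A K i τ)
    (hcov : ∀ K i τ, sh K i τ ≤ ∑ s, piece K i s τ) (hp0 : ∀ K i s τ, 0 ≤ piece K i s τ) (htot : ∀ K i, ∑ τ, A K i τ = 1)
    (l₀ : ℝ) (c : ℕ → ℕ) :
    SlotLedger l₀ (fun _ => (univ : Finset ι))
      (fun K => (fun (K i : ℕ) (_ : ℝ) (τ : ι) => A K i τ) K (c K))
      (fun K => (fun (K i : ℕ) (_ : ℝ) (τ : ι) => sh K i τ) K (c K))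
      (fun _ => (univ : Finset κ))
      (fun K => (fun (K i : ℕ) (_ : ℝ) (s : κ) (τ : ι) => piece K i s τ) K (c K))
      (fun K s => Real.exp (2 * 0) *
        ((∑ τ ∈ (univ : Finset ι), (fun (K i : ℕ) (_ : ℝ) (s : κ) (τ : ι) => piece K i s τ) K (c K) 0 s τ) /
          ∑ τ ∈ (univ : Finset ι), (fun (K i : ℕ) (_ : ℝ) (τ : ι) => A K i τ) K (c K) 0 τ)) := by
  refine SlotLedger.of_realized (a := 0) ?_ ?_ ?_ ?_ ?_ ?_ ?_
  · intro K t _ τ _; exact h0 K (c K) τ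
  · intro K t _ τ _; exact hle K (c K) τ
  · intro K t _ τ _; exact hcov K (c K) τ
  · intro K s _ τ _; exact hp0 K (c K) s τ
  · intro K
    show 0 < ∑ τ, A K (c K) τ
    rw [htot]; exact one_pos
  · intro K t _ s _
    rw [Real.exp_zero, one_mul]
  · intro K t _
    simp only [Real.exp_zero, one_mul, le_refl]

/-- The candidate-summed shell totals of a fixed battery: `Σ_{i<n_K} Σ_s Σ_τ piece_{K,i}(s,τ) ≤ #slots · 1` when, slot by slot, the pieces summed over
the terms AND the candidates are `≤ 1` (for measure data: disjointness of the candidate shells of ONE tested variable). [folklore] -/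
theorem candidateTotals_slots_le (n : ℕ → ℕ) (hdisj : ∀ K s, ∑ i ∈ range (n K), ∑ τ, piece K i s τ ≤ 1) (K : ℕ) :
    ∑ i ∈ range (n K), ∑ s ∈ (univ : Finset κ), ∑ τ ∈ (univ : Finset ι),
        (fun (K i : ℕ) (_ : ℝ) (s : κ) (τ : ι) => piece K i s τ) K i 0 s τ ≤ (Fintype.card κ : ℝ) * 1 := by
  show ∑ i ∈ range (n K), ∑ s, ∑ τ, piece K i s τ ≤ _
  rw [sum_comm, mul_one]
  calc ∑ s, ∑ i ∈ range (n K), ∑ τ, piece K i s τ ≤ ∑ _s : κ, (1 : ℝ) := sum_le_sum fun s _ => hdisj K s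
    _ = Fintype.card κ := by rw [sum_const, card_univ, nsmul_eq_mul, mul_one]

variable (B shB : ℕ → ℕ → ι → ℝ) (pieceB : ℕ → ℕ → κ → ι → ℝ)

/-- **A FIXED BATTERY OF `#κ` SLOTS FIRES ROAD (δ)'s CONSTRUCTOR WITH `V = #κ`, WHATEVER THE TERMS — WITH THE EXPLICIT GEOMETRIC CEILING.**  Two runs'
abstract slot systems on a common finite term set `ι` (`0 ≤ sh^X ≤ A^X`, `sh^X ≤ Σ_s piece^X`, `piece^X ≥ 0`, `Σ_τ A^X = 1`, per slot
`Σ_{i<n_K} Σ_τ piece^X_{K,i}(s,τ) ≤ 1`), `n_K = ⌊β′∕(c₁ϑ^K)⌋₊` candidates (`0 < c₁`, `2c₁ ≤ β′`, `0 < ϑ < 1`): ONE choice function `i⋆` (the two-run pigeonhole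
`exists_liveFactor_choice_function` with `V = #κ`, `Z = 1`, `M = 4c₁∕β′`) such that BOTH runs' chosen shell totals are `≤ (#κ·4c₁∕β′)·ϑ^K` for every `K`,
and `T4IndicatorShell.ShellWeightBound` holds BY NAME (`shellWeightBound_of_realized`) for the two runs written with the common factor of index `i⋆ K`, with
`Wsh K = Σ_s Σ_τ piece^A_{K,i⋆K} + Σ_s Σ_τ piece^B_{K,i⋆K}` (hence `≤ 2·(#κ·4c₁∕β′)·ϑ^K`).  No product structure, no independence, no law: positivity and the
two displayed sums. [folklore] -/
theorem shellWeightBound_slots (l₀ : ℝ) {c₁ β' ϑ : ℝ} (hc₁ : 0 < c₁) (h2 : 2 * c₁ ≤ β') (hϑ0 : 0 < ϑ) (hϑ1 : ϑ < 1)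
    (hA0 : ∀ K i τ, 0 ≤ sh K i τ) (hAle : ∀ K i τ, sh K i τ ≤ A K i τ) (hAcov : ∀ K i τ, sh K i τ ≤ ∑ s, piece K i s τ)
    (hpA0 : ∀ K i s τ, 0 ≤ piece K i s τ) (hA1 : ∀ K i, ∑ τ, A K i τ = 1)
    (hAdisj : ∀ K s, ∑ i ∈ range ⌊β' / (c₁ * ϑ ^ K)⌋₊, ∑ τ, piece K i s τ ≤ 1)
    (hB0 : ∀ K i τ, 0 ≤ shB K i τ) (hBle : ∀ K i τ, shB K i τ ≤ B K i τ) (hBcov : ∀ K i τ, shB K i τ ≤ ∑ s, pieceB K i s τ)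
    (hpB0 : ∀ K i s τ, 0 ≤ pieceB K i s τ) (hB1 : ∀ K i, ∑ τ, B K i τ = 1)
    (hBdisj : ∀ K s, ∑ i ∈ range ⌊β' / (c₁ * ϑ ^ K)⌋₊, ∑ τ, pieceB K i s τ ≤ 1) :
    ∃ istar : ℕ → ℕ, (∀ K, istar K < ⌊β' / (c₁ * ϑ ^ K)⌋₊ ∧
        ∑ s, ∑ τ, piece K (istar K) s τ ≤ ((Fintype.card κ : ℝ) * (4 * c₁ / β')) * ϑ ^ K ∧
        ∑ s, ∑ τ, pieceB K (istar K) s τ ≤ ((Fintype.card κ : ℝ) * (4 * c₁ / β')) * ϑ ^ K) ∧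
      T4IndicatorShell.ShellWeightBound l₀ (fun _ => (univ : Finset ι))
        (fun K (_ : ℝ) (τ : ι) => A K (istar K) τ) (fun K (_ : ℝ) (τ : ι) => B K (istar K) τ)
        (fun K (_ : ℝ) (τ : ι) => sh K (istar K) τ) (fun K (_ : ℝ) (τ : ι) => shB K (istar K) τ)
        (fun K => ∑ s, ∑ τ, piece K (istar K) s τ + ∑ s, ∑ τ, pieceB K (istar K) s τ) := by
  -- the candidate count at rate `c₁ϑ^K`
  have hrate : ∀ K, 0 < ⌊β' / (c₁ * ϑ ^ K)⌋₊ ∧ (2 : ℝ) / ⌊β' / (c₁ * ϑ ^ K)⌋₊ ≤ (4 * c₁ / β') * ϑ ^ K := by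
    intro K
    have hρ : 0 < c₁ * ϑ ^ K := mul_pos hc₁ (pow_pos hϑ0 K)
    have hρ2 : 2 * (c₁ * ϑ ^ K) ≤ β' := by nlinarith [pow_le_one₀ hϑ0.le hϑ1.le (n := K)]
    obtain ⟨h1, -, h3⟩ := candidateCount_spec hρ hρ2
    exact ⟨h1, h3.trans_eq (by ring)⟩
  have hlA := fun c => realizedLedger_slots A sh piece hA0 hAle hAcov hpA0 hA1 l₀ c
  have hlB := fun c => realizedLedger_slots B shB pieceB hB0 hBle hBcov hpB0 hB1 l₀ c
  -- the two-run pigeonhole from the candidate-summed totals `≤ #κ·1`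
  obtain ⟨istar, histar⟩ := exists_liveFactor_choice_function (fun K => ⌊β' / (c₁ * ϑ ^ K)⌋₊) (fun K => (hrate K).1)
    (fun K i => ∑ s, ∑ τ, piece K i s τ) (fun K i => ∑ s, ∑ τ, pieceB K i s τ) (fun _ => 1) (fun _ => 1)
    (fun _ => one_pos) (fun _ => one_pos)
    (fun K i => sum_nonneg fun s _ => sum_nonneg fun τ _ => hpA0 K i s τ)
    (fun K i => sum_nonneg fun s _ => sum_nonneg fun τ _ => hpB0 K i s τ)
    (V := (Fintype.card κ : ℝ)) (Nat.cast_nonneg _)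
    (fun K => candidateTotals_slots_le piece (fun K => ⌊β' / (c₁ * ϑ ^ K)⌋₊) hAdisj K)
    (fun K => candidateTotals_slots_le pieceB (fun K => ⌊β' / (c₁ * ϑ ^ K)⌋₊) hBdisj K)
    (M := 4 * c₁ / β') (fun K => (hrate K).2)
  refine ⟨istar, fun K => ⟨(histar K).1, ?_, ?_⟩, ?_⟩
  · simpa only [mul_one, mul_assoc] using (histar K).2.1
  · simpa only [mul_one, mul_assoc] using (histar K).2.2
  have hSWB := shellWeightBound_of_realized (hlA istar) (hlB istar)
    (fun K => by show 0 < ∑ τ, A K (istar K) τ; rw [hA1]; exact one_pos)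
    (fun K => by show 0 < ∑ τ, B K (istar K) τ; rw [hB1]; exact one_pos) hϑ0.le hϑ1
    (C := (Fintype.card κ : ℝ) * (4 * c₁ / β'))
    (fun K => by
      show ∑ s, ∑ τ, piece K (istar K) s τ ≤ ((Fintype.card κ : ℝ) * (4 * c₁ / β') * ϑ ^ K) * ∑ τ, A K (istar K) τ
      rw [hA1]; simpa only [mul_one, mul_assoc] using (histar K).2.1)
    (fun K => by
      show ∑ s, ∑ τ, pieceB K (istar K) s τ ≤ ((Fintype.card κ : ℝ) * (4 * c₁ / β') * ϑ ^ K) * ∑ τ, B K (istar K) τ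
      rw [hB1]; simpa only [mul_one, mul_assoc] using (histar K).2.2)
  have e : (fun K => (hlA istar).omega K + (hlB istar).omega K) =
      (fun K => ∑ s, ∑ τ, piece K (istar K) s τ + ∑ s, ∑ τ, pieceB K (istar K) s τ) := by
    funext K
    simp only [SlotLedger.omega, mul_zero, Real.exp_zero, one_mul]
    rw [hA1, hB1]
    simp only [div_one]
  rw [← e]
  exact hSWB

end Abstract

/-! ## §2 The joint-law instance: `S` threshold tests of ARBITRARILY DEPENDENT real observables on ANY probability space (one per run and
per comparison `K`); terms = the `2^S` cells of the battery, shell part = the cell's mass on «some tested variable within its two-sided shell» -/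

section Cells

variable {Ω : Type*} {T : Type*}

/-- Distinct outcome strings give disjoint cells. [folklore] -/
theorem cell_disjoint (v : T → Ω → ℝ) (a : T → ℝ) {ω ω' : T → Bool} (h : ω ≠ ω') :
    Disjoint (⋂ σ, (v σ) ⁻¹' (if ω σ then Iio (a σ) else Ici (a σ))) (⋂ σ, (v σ) ⁻¹' (if ω' σ then Iio (a σ) else Ici (a σ))) := by
  obtain ⟨σ, hσ⟩ := Function.ne_iff.1 h
  rw [Set.disjoint_left]
  intro x hx hx'
  have h1 := Set.mem_iInter.1 hx σ; have h2 := Set.mem_iInter.1 hx' σ; rw [Set.mem_preimage] at h1 h2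
  cases hω : ω σ <;> cases hω' : ω' σ <;> first
    | exact hσ (hω.trans hω'.symm)
    | (rw [hω] at h1; rw [hω'] at h2
       simp only [Bool.false_eq_true, if_false, Set.mem_Ici, if_true, Set.mem_Iio] at h1 h2; linarith)

/-- The cells exhaust the space (every configuration has an outcome string). [folklore] -/
theorem iUnion_cell (v : T → Ω → ℝ) (a : T → ℝ) :
    (⋃ ω : T → Bool, ⋂ σ, (v σ) ⁻¹' (if ω σ then Iio (a σ) else Ici (a σ))) = univ := by
  refine Set.eq_univ_of_forall fun x => Set.mem_iUnion.2 ⟨fun σ => decide (v σ x < a σ), Set.mem_iInter.2 fun σ => ?_⟩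
  rw [Set.mem_preimage]
  by_cases h : v σ x < a σ
  · simp only [h, decide_true, if_true, Set.mem_Iio]
  · simp only [h, decide_false, Bool.false_eq_true, if_false, Set.mem_Ici]
    exact not_lt.1 h

variable [Fintype T] [MeasurableSpace Ω]

/-- The cells of a battery of `S` sharp tests `v_σ <? a_σ` are measurable (`v_σ` measurable). [folklore] -/
theorem measurableSet_cell {v : T → Ω → ℝ} (hv : ∀ σ, Measurable (v σ)) (a : T → ℝ) (ω : T → Bool) :
    MeasurableSet (⋂ σ, (v σ) ⁻¹' (if ω σ then Iio (a σ) else Ici (a σ))) :=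
  MeasurableSet.iInter fun σ => hv σ (by split <;> [exact measurableSet_Iio; exact measurableSet_Ici])

variable (P : Measure Ω)

/-- **UNION BOUND** (the ledger's `cover`): a cell's mass on «some tested variable in its shell» is at most the sum over the slots. [folklore] -/
theorem measureReal_inter_iUnion_le (C : Set Ω) (E : T → Set Ω) :
    P.real (C ∩ ⋃ σ, E σ) ≤ ∑ σ, P.real (C ∩ E σ) := by
  rw [Set.inter_iUnion]; exact measureReal_iUnion_fintype_le _

variable [DecidableEq T] [IsProbabilityMeasure P]

/-- **PARTITION**: for a measurable event `E`, the masses of `E` on the `2^S` cells sum to `P(E)`. [folklore] -/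
theorem sum_measureReal_cell_inter {v : T → Ω → ℝ} (hv : ∀ σ, Measurable (v σ)) (a : T → ℝ) {E : Set Ω}
    (hE : MeasurableSet E) :
    ∑ ω : T → Bool, P.real ((⋂ σ, (v σ) ⁻¹' (if ω σ then Iio (a σ) else Ici (a σ))) ∩ E) = P.real E := by
  rw [← measureReal_iUnion_fintype (fun ω ω' hne => (cell_disjoint v a hne).mono Set.inter_subset_left Set.inter_subset_left)
    (fun ω => (measurableSet_cell hv a ω).inter hE), ← Set.iUnion_inter, iUnion_cell, univ_inter]

/-- the total weight of the cells is `1`. [folklore] -/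
theorem sum_measureReal_cell {v : T → Ω → ℝ} (hv : ∀ σ, Measurable (v σ)) (a : T → ℝ) :
    ∑ ω : T → Bool, P.real (⋂ σ, (v σ) ⁻¹' (if ω σ then Iio (a σ) else Ici (a σ))) = 1 := by
  have h := sum_measureReal_cell_inter P hv a MeasurableSet.univ
  simp only [Set.inter_univ, probReal_univ] at h
  exact h

/-- **DISJOINTNESS OF THE CANDIDATE SHELLS OF ONE TESTED VARIABLE** — the only place the law enters: for `0 ≤ θ`, `0 ≤ ρ`, `2ρ ≤ ρ⋆ ≤ 1`, a measurable
`v : Ω → ℝ` and ANY probability law, `Σ_{i<n} P{v ∈ twoSidedShell θ ρ⋆ ρ i} ≤ 1`. [folklore] -/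
theorem sum_measureReal_preimage_twoSidedShell_le_one {v : Ω → ℝ} (hv : Measurable v) {θ ρ ρstar : ℝ} (hθ : 0 ≤ θ) (hρ0 : 0 ≤ ρ)
    (h2 : 2 * ρ ≤ ρstar) (h1 : ρstar ≤ 1) (n : ℕ) :
    ∑ i ∈ range n, P.real (v ⁻¹' twoSidedShell θ ρstar ρ i) ≤ 1 := by
  calc ∑ i ∈ range n, P.real (v ⁻¹' twoSidedShell θ ρstar ρ i)
      = P.real (⋃ i ∈ range n, v ⁻¹' twoSidedShell θ ρstar ρ i) := by
        rw [measureReal_biUnion_finset (fun i _ j _ hij => (twoSidedShell_disjoint hθ hρ0 h2 h1 hij).preimage v)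
          (fun i _ => hv measurableSet_Ico)]
    _ ≤ P.real (univ : Set Ω) := measureReal_mono (subset_univ _)
    _ = 1 := probReal_univ

end Cells

/-! ### The joint-law constructor: ANY probability spaces, ANY measurable tested observables, `V = S` -/

section JointLaw

variable {S : ℕ} {ΩA ΩB : ℕ → Type*} [∀ K, MeasurableSpace (ΩA K)] [∀ K, MeasurableSpace (ΩB K)]
  (PA : ∀ K, Measure (ΩA K)) (PB : ∀ K, Measure (ΩB K)) [∀ K, IsProbabilityMeasure (PA K)] [∀ K, IsProbabilityMeasure (PB K)]
  (uA : ∀ K, Fin S → ΩA K → ℝ) (uB : ∀ K, Fin S → ΩB K → ℝ) (θ ρA ρB : ℕ → Fin S → ℝ)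

/-- **ROAD (δ)'s END-TO-END CONSTRUCTOR FIRES ON THE JOINT-LAW MODEL — NO INDEPENDENCE, NO DENSITY, NO ANTI-CONCENTRATION.**  For every
comparison `K`, run `X ∈ {A, B}` lives on ITS OWN probability space `(Ω^X_K, P^X_K)` (ANY) and tests `S` measurable real observables `u^X_{K,σ}`
(ARBITRARILY DEPENDENT — e.g. functions of one and the same field) against the thresholds `θ_{K,σ}·λ_i`, `λ_i = (1 − c₁ϑ^K)^i` the COMMON live
factor; `0 ≤ θ`, own closeness radii `0 ≤ ρ^X_{K,σ}`, `2ρ^X_{K,σ} ≤ c₁ϑ^K`, `0 < c₁`, `2c₁ ≤ β′ ≤ 1`, `0 < ϑ < 1`.  TERMS = the `2^S` cells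
`ω : Fin S → Bool` of the battery (weight = the cell's probability); SHELL PART of a cell = its probability mass on «some tested observable within its
two-sided shell `twoSidedShell θ_{K,σ} (c₁ϑ^K) ρ^X_{K,σ} i`» (where the other run's sharp indicator may disagree); slot `σ`'s piece = the cell's mass
on «`u_σ` in its shell».  Then ONE choice function `i⋆` gives, for BOTH runs and every `K`, the total chosen shell mass `Σ_σ P^X_K{u^X_{K,σ} ∈ shell_{i⋆K}}
≤ (S·4c₁∕β′)·ϑ^K` (`V = S`), and `T4IndicatorShell.ShellWeightBound` BY NAME with `Wsh K = Σ_σ P^A_K{u^A_{K,σ} ∈ shell} + Σ_σ P^B_K{u^B_{K,σ} ∈ shell}`;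
consumed of the laws: σ-additivity (cells partition; union bound over the slots; the `⌊β′∕(c₁ϑ^K)⌋₊` candidate shells of ONE observable are disjoint).
[folklore] -/
theorem shellWeightBound_jointLaw (l₀ : ℝ) {c₁ β' ϑ : ℝ} (hc₁ : 0 < c₁) (h2 : 2 * c₁ ≤ β') (hβ1 : β' ≤ 1)
    (hϑ0 : 0 < ϑ) (hϑ1 : ϑ < 1) (huA : ∀ K σ, Measurable (uA K σ)) (huB : ∀ K σ, Measurable (uB K σ)) (hθ : ∀ K σ, 0 ≤ θ K σ)
    (hA0 : ∀ K σ, 0 ≤ ρA K σ) (hA2 : ∀ K σ, 2 * ρA K σ ≤ c₁ * ϑ ^ K) (hB0 : ∀ K σ, 0 ≤ ρB K σ) (hB2 : ∀ K σ, 2 * ρB K σ ≤ c₁ * ϑ ^ K) :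
    ∃ istar : ℕ → ℕ, (∀ K, istar K < ⌊β' / (c₁ * ϑ ^ K)⌋₊ ∧
        ∑ σ, (PA K).real ((uA K σ) ⁻¹' twoSidedShell (θ K σ) (c₁ * ϑ ^ K) (ρA K σ) (istar K)) ≤ ((S : ℝ) * (4 * c₁ / β')) * ϑ ^ K ∧
        ∑ σ, (PB K).real ((uB K σ) ⁻¹' twoSidedShell (θ K σ) (c₁ * ϑ ^ K) (ρB K σ) (istar K)) ≤ ((S : ℝ) * (4 * c₁ / β')) * ϑ ^ K) ∧
      T4IndicatorShell.ShellWeightBound l₀ (fun _ => (univ : Finset (Fin S → Bool)))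
        (fun K (_ : ℝ) (ω : Fin S → Bool) => (PA K).real (⋂ τ, (uA K τ) ⁻¹' (if ω τ then Iio (θ K τ * (1 - c₁ * ϑ ^ K) ^ istar K) else Ici (θ K τ * (1 - c₁ * ϑ ^ K) ^ istar K))))
        (fun K (_ : ℝ) (ω : Fin S → Bool) => (PB K).real (⋂ τ, (uB K τ) ⁻¹' (if ω τ then Iio (θ K τ * (1 - c₁ * ϑ ^ K) ^ istar K) else Ici (θ K τ * (1 - c₁ * ϑ ^ K) ^ istar K))))
        (fun K (_ : ℝ) (ω : Fin S → Bool) =>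
          (PA K).real ((⋂ τ, (uA K τ) ⁻¹' (if ω τ then Iio (θ K τ * (1 - c₁ * ϑ ^ K) ^ istar K) else Ici (θ K τ * (1 - c₁ * ϑ ^ K) ^ istar K))) ∩ ⋃ σ, (uA K σ) ⁻¹' twoSidedShell (θ K σ) (c₁ * ϑ ^ K) (ρA K σ) (istar K)))
        (fun K (_ : ℝ) (ω : Fin S → Bool) =>
          (PB K).real ((⋂ τ, (uB K τ) ⁻¹' (if ω τ then Iio (θ K τ * (1 - c₁ * ϑ ^ K) ^ istar K) else Ici (θ K τ * (1 - c₁ * ϑ ^ K) ^ istar K))) ∩ ⋃ σ, (uB K σ) ⁻¹' twoSidedShell (θ K σ) (c₁ * ϑ ^ K) (ρB K σ) (istar K)))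
        (fun K => ∑ σ, (PA K).real ((uA K σ) ⁻¹' twoSidedShell (θ K σ) (c₁ * ϑ ^ K) (ρA K σ) (istar K)) + ∑ σ, (PB K).real ((uB K σ) ⁻¹' twoSidedShell (θ K σ) (c₁ * ϑ ^ K) (ρB K σ) (istar K))) := by
  have hs1 : ∀ K, c₁ * ϑ ^ K ≤ 1 := fun K => by
    have := mul_le_mul_of_nonneg_left (pow_le_one₀ hϑ0.le hϑ1.le : ϑ ^ K ≤ 1) hc₁.le
    linarith
  -- slot by slot, the pieces summed over the cells are the MARGINAL shell masses (partition)
  have eA : ∀ K i σ, ∑ ω : Fin S → Bool, (PA K).real ((⋂ τ, (uA K τ) ⁻¹' (if ω τ then Iio (θ K τ * (1 - c₁ * ϑ ^ K) ^ i) else Ici (θ K τ * (1 - c₁ * ϑ ^ K) ^ i))) ∩ (uA K σ) ⁻¹' twoSidedShell (θ K σ) (c₁ * ϑ ^ K) (ρA K σ) i) = (PA K).real ((uA K σ) ⁻¹' twoSidedShell (θ K σ) (c₁ * ϑ ^ K) (ρA K σ) i) :=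
    fun K i σ => sum_measureReal_cell_inter (PA K) (huA K) _ ((huA K σ) measurableSet_Ico)
  have eB : ∀ K i σ, ∑ ω : Fin S → Bool, (PB K).real ((⋂ τ, (uB K τ) ⁻¹' (if ω τ then Iio (θ K τ * (1 - c₁ * ϑ ^ K) ^ i) else Ici (θ K τ * (1 - c₁ * ϑ ^ K) ^ i))) ∩ (uB K σ) ⁻¹' twoSidedShell (θ K σ) (c₁ * ϑ ^ K) (ρB K σ) i) = (PB K).real ((uB K σ) ⁻¹' twoSidedShell (θ K σ) (c₁ * ϑ ^ K) (ρB K σ) i) :=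
    fun K i σ => sum_measureReal_cell_inter (PB K) (huB K) _ ((huB K σ) measurableSet_Ico)
  obtain ⟨istar, hlt, h⟩ := shellWeightBound_slots
    (A := fun K i (ω : Fin S → Bool) => (PA K).real (⋂ τ, (uA K τ) ⁻¹' (if ω τ then Iio (θ K τ * (1 - c₁ * ϑ ^ K) ^ i) else Ici (θ K τ * (1 - c₁ * ϑ ^ K) ^ i))))
    (sh := fun K i (ω : Fin S → Bool) => (PA K).real ((⋂ τ, (uA K τ) ⁻¹' (if ω τ then Iio (θ K τ * (1 - c₁ * ϑ ^ K) ^ i) else Ici (θ K τ * (1 - c₁ * ϑ ^ K) ^ i))) ∩ ⋃ σ, (uA K σ) ⁻¹' twoSidedShell (θ K σ) (c₁ * ϑ ^ K) (ρA K σ) i))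
    (piece := fun K i (σ : Fin S) (ω : Fin S → Bool) => (PA K).real ((⋂ τ, (uA K τ) ⁻¹' (if ω τ then Iio (θ K τ * (1 - c₁ * ϑ ^ K) ^ i) else Ici (θ K τ * (1 - c₁ * ϑ ^ K) ^ i))) ∩ (uA K σ) ⁻¹' twoSidedShell (θ K σ) (c₁ * ϑ ^ K) (ρA K σ) i))
    (B := fun K i (ω : Fin S → Bool) => (PB K).real (⋂ τ, (uB K τ) ⁻¹' (if ω τ then Iio (θ K τ * (1 - c₁ * ϑ ^ K) ^ i) else Ici (θ K τ * (1 - c₁ * ϑ ^ K) ^ i))))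
    (shB := fun K i (ω : Fin S → Bool) => (PB K).real ((⋂ τ, (uB K τ) ⁻¹' (if ω τ then Iio (θ K τ * (1 - c₁ * ϑ ^ K) ^ i) else Ici (θ K τ * (1 - c₁ * ϑ ^ K) ^ i))) ∩ ⋃ σ, (uB K σ) ⁻¹' twoSidedShell (θ K σ) (c₁ * ϑ ^ K) (ρB K σ) i))
    (pieceB := fun K i (σ : Fin S) (ω : Fin S → Bool) => (PB K).real ((⋂ τ, (uB K τ) ⁻¹' (if ω τ then Iio (θ K τ * (1 - c₁ * ϑ ^ K) ^ i) else Ici (θ K τ * (1 - c₁ * ϑ ^ K) ^ i))) ∩ (uB K σ) ⁻¹' twoSidedShell (θ K σ) (c₁ * ϑ ^ K) (ρB K σ) i))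
    l₀ hc₁ h2 hϑ0 hϑ1
    (fun K i ω => measureReal_nonneg) (fun K i ω => measureReal_mono inter_subset_left)
    (fun K i ω => measureReal_inter_iUnion_le (PA K) _ _) (fun K i σ ω => measureReal_nonneg)
    (fun K i => sum_measureReal_cell (PA K) (huA K) _)
    (fun K σ => by
      calc ∑ i ∈ range ⌊β' / (c₁ * ϑ ^ K)⌋₊, ∑ ω : Fin S → Bool, (PA K).real ((⋂ τ, (uA K τ) ⁻¹' (if ω τ then Iio (θ K τ * (1 - c₁ * ϑ ^ K) ^ i) else Ici (θ K τ * (1 - c₁ * ϑ ^ K) ^ i))) ∩ (uA K σ) ⁻¹' twoSidedShell (θ K σ) (c₁ * ϑ ^ K) (ρA K σ) i)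
          = ∑ i ∈ range ⌊β' / (c₁ * ϑ ^ K)⌋₊, (PA K).real ((uA K σ) ⁻¹' twoSidedShell (θ K σ) (c₁ * ϑ ^ K) (ρA K σ) i) := sum_congr rfl fun i _ => eA K i σ
        _ ≤ 1 := sum_measureReal_preimage_twoSidedShell_le_one (PA K) (huA K σ) (hθ K σ) (hA0 K σ) (hA2 K σ) (hs1 K) _)
    (fun K i ω => measureReal_nonneg) (fun K i ω => measureReal_mono inter_subset_left)
    (fun K i ω => measureReal_inter_iUnion_le (PB K) _ _) (fun K i σ ω => measureReal_nonneg)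
    (fun K i => sum_measureReal_cell (PB K) (huB K) _)
    (fun K σ => by
      calc ∑ i ∈ range ⌊β' / (c₁ * ϑ ^ K)⌋₊, ∑ ω : Fin S → Bool, (PB K).real ((⋂ τ, (uB K τ) ⁻¹' (if ω τ then Iio (θ K τ * (1 - c₁ * ϑ ^ K) ^ i) else Ici (θ K τ * (1 - c₁ * ϑ ^ K) ^ i))) ∩ (uB K σ) ⁻¹' twoSidedShell (θ K σ) (c₁ * ϑ ^ K) (ρB K σ) i)
          = ∑ i ∈ range ⌊β' / (c₁ * ϑ ^ K)⌋₊, (PB K).real ((uB K σ) ⁻¹' twoSidedShell (θ K σ) (c₁ * ϑ ^ K) (ρB K σ) i) := sum_congr rfl fun i _ => eB K i σ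
        _ ≤ 1 := sum_measureReal_preimage_twoSidedShell_le_one (PB K) (huB K σ) (hθ K σ) (hB0 K σ) (hB2 K σ) (hs1 K) _)
  have eA' : ∀ K, ∑ σ, ∑ ω : Fin S → Bool, (PA K).real ((⋂ τ, (uA K τ) ⁻¹' (if ω τ then Iio (θ K τ * (1 - c₁ * ϑ ^ K) ^ istar K) else Ici (θ K τ * (1 - c₁ * ϑ ^ K) ^ istar K))) ∩ (uA K σ) ⁻¹' twoSidedShell (θ K σ) (c₁ * ϑ ^ K) (ρA K σ) (istar K)) =
      ∑ σ, (PA K).real ((uA K σ) ⁻¹' twoSidedShell (θ K σ) (c₁ * ϑ ^ K) (ρA K σ) (istar K)) :=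
    fun K => sum_congr rfl fun σ _ => eA K (istar K) σ
  have eB' : ∀ K, ∑ σ, ∑ ω : Fin S → Bool, (PB K).real ((⋂ τ, (uB K τ) ⁻¹' (if ω τ then Iio (θ K τ * (1 - c₁ * ϑ ^ K) ^ istar K) else Ici (θ K τ * (1 - c₁ * ϑ ^ K) ^ istar K))) ∩ (uB K σ) ⁻¹' twoSidedShell (θ K σ) (c₁ * ϑ ^ K) (ρB K σ) (istar K)) =
      ∑ σ, (PB K).real ((uB K σ) ⁻¹' twoSidedShell (θ K σ) (c₁ * ϑ ^ K) (ρB K σ) (istar K)) :=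
    fun K => sum_congr rfl fun σ _ => eB K (istar K) σ
  refine ⟨istar, fun K => ⟨(hlt K).1, ?_, ?_⟩, ?_⟩
  · have h1 := (hlt K).2.1
    rw [eA' K, Fintype.card_fin] at h1
    exact h1
  · have h1 := (hlt K).2.2
    rw [eB' K, Fintype.card_fin] at h1
    exact h1
  have e : (fun K => ∑ σ, ∑ ω : Fin S → Bool, (PA K).real ((⋂ τ, (uA K τ) ⁻¹' (if ω τ then Iio (θ K τ * (1 - c₁ * ϑ ^ K) ^ istar K) else Ici (θ K τ * (1 - c₁ * ϑ ^ K) ^ istar K))) ∩ (uA K σ) ⁻¹' twoSidedShell (θ K σ) (c₁ * ϑ ^ K) (ρA K σ) (istar K)) +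
        ∑ σ, ∑ ω : Fin S → Bool, (PB K).real ((⋂ τ, (uB K τ) ⁻¹' (if ω τ then Iio (θ K τ * (1 - c₁ * ϑ ^ K) ^ istar K) else Ici (θ K τ * (1 - c₁ * ϑ ^ K) ^ istar K))) ∩ (uB K σ) ⁻¹' twoSidedShell (θ K σ) (c₁ * ϑ ^ K) (ρB K σ) (istar K))) =
      (fun K => ∑ σ, (PA K).real ((uA K σ) ⁻¹' twoSidedShell (θ K σ) (c₁ * ϑ ^ K) (ρA K σ) (istar K)) + ∑ σ, (PB K).real ((uB K σ) ⁻¹' twoSidedShell (θ K σ) (c₁ * ϑ ^ K) (ρB K σ) (istar K))) := by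
    funext K
    rw [eA' K, eB' K]
  rw [← e]
  exact h

end JointLaw

/-! ## §3 The level-0 LATTICE instance: Wilson's Gibbs measures along ANY torus scheme, step `K` against step `K + 1`, a battery of `S`
plaquette tests `1 − Re tr U(∂p) <? θ·λ` per run -/

section Lattice

variable {G : Type*} [GaugeGroup G] [MeasurableSpace G] [RegularGaugeGroup G] [HaarData G] {O : Type*}
  (Sch : Missing.TorusScheme G O) {S : ℕ} (pA : ∀ K, Fin S → Plaq (Sch.P K) 0) (pB : ∀ K, Fin S → Plaq (Sch.P (K + 1)) 0)
  (θ ρA ρB : ℕ → Fin S → ℝ)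

/-- **ROAD (δ)'s CONSTRUCTOR FIRES AT LEVEL 0 ON THE LATTICE, FOR EVERY TORUS SCHEME OF THE CELL.**  `G` any regular gauge group of the tree
(`[RegularGaugeGroup G] [HaarData G]`: `U(N)`, `SU(N)`, …), `Sch` ANY `Missing.TorusScheme G O` with `β_K ≥ 0` (the object whose continuum limit is
the headline `ContinuumYM4Torus`); the `K`-th comparison puts run A = Wilson's Gibbs measure `Z⁻¹e^{−β_K A}∏dU` on `T^{(0)}_K`
(`T4GenFunBounds.gibbsMeasure (Sch.P K) (Sch.β K)`) against run B = the same at step `K + 1`, each testing `S` plaquette action densities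
`1 − Re tr U(∂p^X_{K,σ})` ([B12] (0.2); `Missing.plaqLoop`) — functions of ONE interacting gauge field, NOT independent — against `θ_{K,σ}·(1 − c₁ϑ^K)^i`.
Conclusion: ONE common live factor index `i⋆ K < ⌊β′∕(c₁ϑ^K)⌋₊` per `K` with `Σ_σ Gibbs_K{1 − Re tr U(∂p^A_σ) ∈ shell_{i⋆K}} ≤ (S·4c₁∕β′)·ϑ^K`, the same
for step `K + 1`, and §2's `ShellWeightBound` BY NAME (`V = S`), `Wsh K = Σ_σ Gibbs_K{1 − Re tr U(∂p^A_σ) ∈ shell} + Σ_σ Gibbs_{K+1}{1 − Re tr U(∂p^B_σ) ∈ shell}`.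
A MODEL of the two-run comparison at level 0 (a FIXED battery; Bałaban's terms (2.18) are an ADAPTIVE, `K`-level decision tree — node O). [folklore] -/
theorem shellWeightBound_wilsonScheme (hβ : ∀ K, 0 ≤ Sch.β K) (l₀ : ℝ) {c₁ β' ϑ : ℝ} (hc₁ : 0 < c₁) (h2 : 2 * c₁ ≤ β') (hβ1 : β' ≤ 1)
    (hϑ0 : 0 < ϑ) (hϑ1 : ϑ < 1) (hθ : ∀ K σ, 0 ≤ θ K σ)
    (hA0 : ∀ K σ, 0 ≤ ρA K σ) (hA2 : ∀ K σ, 2 * ρA K σ ≤ c₁ * ϑ ^ K) (hB0 : ∀ K σ, 0 ≤ ρB K σ) (hB2 : ∀ K σ, 2 * ρB K σ ≤ c₁ * ϑ ^ K) :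
    ∃ istar : ℕ → ℕ, (∀ K, istar K < ⌊β' / (c₁ * ϑ ^ K)⌋₊ ∧
        ∑ σ, (T4GenFunBounds.gibbsMeasure (G := G) (Sch.P K) (Sch.β K)).real
            ((fun U : GaugeField (Sch.P K) 0 G => 1 - Missing.plaqLoop (pA K σ) U) ⁻¹' twoSidedShell (θ K σ) (c₁ * ϑ ^ K) (ρA K σ) (istar K)) ≤
          ((S : ℝ) * (4 * c₁ / β')) * ϑ ^ K ∧
        ∑ σ, (T4GenFunBounds.gibbsMeasure (G := G) (Sch.P (K + 1)) (Sch.β (K + 1))).real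
            ((fun U : GaugeField (Sch.P (K + 1)) 0 G => 1 - Missing.plaqLoop (pB K σ) U) ⁻¹' twoSidedShell (θ K σ) (c₁ * ϑ ^ K) (ρB K σ) (istar K)) ≤
          ((S : ℝ) * (4 * c₁ / β')) * ϑ ^ K) ∧
      T4IndicatorShell.ShellWeightBound l₀ (fun _ => (univ : Finset (Fin S → Bool)))
        (fun K (_ : ℝ) (ω : Fin S → Bool) => (T4GenFunBounds.gibbsMeasure (G := G) (Sch.P K) (Sch.β K)).real (⋂ τ, (fun U : GaugeField (Sch.P K) 0 G => 1 - Missing.plaqLoop (pA K τ) U) ⁻¹' (if ω τ then Iio (θ K τ * (1 - c₁ * ϑ ^ K) ^ istar K) else Ici (θ K τ * (1 - c₁ * ϑ ^ K) ^ istar K))))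
        (fun K (_ : ℝ) (ω : Fin S → Bool) => (T4GenFunBounds.gibbsMeasure (G := G) (Sch.P (K + 1)) (Sch.β (K + 1))).real (⋂ τ, (fun U : GaugeField (Sch.P (K + 1)) 0 G => 1 - Missing.plaqLoop (pB K τ) U) ⁻¹' (if ω τ then Iio (θ K τ * (1 - c₁ * ϑ ^ K) ^ istar K) else Ici (θ K τ * (1 - c₁ * ϑ ^ K) ^ istar K))))
        (fun K (_ : ℝ) (ω : Fin S → Bool) =>
          (T4GenFunBounds.gibbsMeasure (G := G) (Sch.P K) (Sch.β K)).real ((⋂ τ, (fun U : GaugeField (Sch.P K) 0 G => 1 - Missing.plaqLoop (pA K τ) U) ⁻¹' (if ω τ then Iio (θ K τ * (1 - c₁ * ϑ ^ K) ^ istar K) else Ici (θ K τ * (1 - c₁ * ϑ ^ K) ^ istar K))) ∩ ⋃ σ, (fun U : GaugeField (Sch.P K) 0 G => 1 - Missing.plaqLoop (pA K σ) U) ⁻¹' twoSidedShell (θ K σ) (c₁ * ϑ ^ K) (ρA K σ) (istar K)))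
        (fun K (_ : ℝ) (ω : Fin S → Bool) =>
          (T4GenFunBounds.gibbsMeasure (G := G) (Sch.P (K + 1)) (Sch.β (K + 1))).real ((⋂ τ, (fun U : GaugeField (Sch.P (K + 1)) 0 G => 1 - Missing.plaqLoop (pB K τ) U) ⁻¹' (if ω τ then Iio (θ K τ * (1 - c₁ * ϑ ^ K) ^ istar K) else Ici (θ K τ * (1 - c₁ * ϑ ^ K) ^ istar K))) ∩ ⋃ σ, (fun U : GaugeField (Sch.P (K + 1)) 0 G => 1 - Missing.plaqLoop (pB K σ) U) ⁻¹' twoSidedShell (θ K σ) (c₁ * ϑ ^ K) (ρB K σ) (istar K)))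
        (fun K => ∑ σ, (T4GenFunBounds.gibbsMeasure (G := G) (Sch.P K) (Sch.β K)).real ((fun U : GaugeField (Sch.P K) 0 G => 1 - Missing.plaqLoop (pA K σ) U) ⁻¹' twoSidedShell (θ K σ) (c₁ * ϑ ^ K) (ρA K σ) (istar K)) + ∑ σ, (T4GenFunBounds.gibbsMeasure (G := G) (Sch.P (K + 1)) (Sch.β (K + 1))).real ((fun U : GaugeField (Sch.P (K + 1)) 0 G => 1 - Missing.plaqLoop (pB K σ) U) ⁻¹' twoSidedShell (θ K σ) (c₁ * ϑ ^ K) (ρB K σ) (istar K))) := by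
  haveI : ∀ K, IsProbabilityMeasure (T4GenFunBounds.gibbsMeasure (G := G) (Sch.P K) (Sch.β K)) :=
    fun K => T4GenFunBounds.isProbabilityMeasure_gibbsMeasure _ (hβ K)
  haveI : ∀ K, IsProbabilityMeasure (T4GenFunBounds.gibbsMeasure (G := G) (Sch.P (K + 1)) (Sch.β (K + 1))) :=
    fun K => T4GenFunBounds.isProbabilityMeasure_gibbsMeasure _ (hβ (K + 1))
  exact shellWeightBound_jointLaw (ΩA := fun K => GaugeField (Sch.P K) 0 G) (ΩB := fun K => GaugeField (Sch.P (K + 1)) 0 G)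
    (fun K => T4GenFunBounds.gibbsMeasure (G := G) (Sch.P K) (Sch.β K)) (fun K => T4GenFunBounds.gibbsMeasure (G := G) (Sch.P (K + 1)) (Sch.β (K + 1)))
    (fun K σ (U : GaugeField (Sch.P K) 0 G) => 1 - Missing.plaqLoop (pA K σ) U)
    (fun K σ (U : GaugeField (Sch.P (K + 1)) 0 G) => 1 - Missing.plaqLoop (pB K σ) U) θ ρA ρB l₀ hc₁ h2 hβ1 hϑ0 hϑ1
    (fun K σ => measurable_const.sub (Missing.measurable_plaqLoop' (pA K σ)))
    (fun K σ => measurable_const.sub (Missing.measurable_plaqLoop' (pB K σ))) hθ hA0 hA2 hB0 hB2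

end Lattice




end Summit.QuantumFields.BalabanUV.T4Continuum.Spine.NE7c.LiveFactorJointLawModel

end
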